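import Literature.Probability.Percolation.InequalitiesProofs
import HarnessLib

/-!
# Reimer certificates: a packing kernel for antipodal (configuration-versus-complement) counts

Helper file for crux `stmt-CriticalPhenomena-4575` (`NoHeavyLowerTail`, route `PercNearOneGluingNoHeavy`),
seat `prim-l12-p1` gen 7; memo `run/shared/lean/prim/prim-l12/FROM-prim-l12-p1-g7-REIMER-CERTIFICATES.md`.
Everything here is PROVED (finite combinatorics on the cube `{0,1}^α`); no definitions, no route
declaration is touched.

**Context.**  The open all-`n` row `Q44b` (and its lattice form OTA of `prim-l12-p6` gen 9) is a
count on one fibre cube: `#Good ≥ #Bad`, where a point `x : α → Bool` is good/bad according to the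
pair (pattern of `x`, pattern of the complement `x̄ = fun i => !x i`).  The Marica–Schönheim route
(`Q44bMS`, `OrientedAntipodalHall`) injects bad points into good ones through differences.  This
file records the strictly larger proof object furnished by **Reimer's flip lemma**
`|A □ B| ≤ |A ∩ B̄|` (tree: `Literature.Probability.Percolation.reimer_flip_card_le`,
Reimer 2000 Thm. 1.2):

* A *certificate* for `(Bad, Good)` is a representative map `ρ`, injective on `Bad`, and a witness
  set `K t` for every bad `t`.  With `A = ⋃_{t ∈ Bad} Cyl(ρ t, K t)` (agree with `ρ t` on `K t`) and
  `B = ⋃_{t ∈ Bad} coCyl(ρ t, K t)` (agree with `ρ t` off `K t`) one has `ρ(Bad) ⊆ A □ B`, so Reimer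
  gives `#Bad ≤ #(A ∩ B̄)` (`card_le_card_obligation`).  The *obligation set* `A ∩ B̄` is, pointwise,
  the PAIRWISE finite check `Obl x`: `x` agrees with some `ρ t₁` on `K t₁` and `x̄` agrees with some
  `ρ t₂` off `K t₂` (`mem_obligation_iff`).
* `card_le_card_of_pairwise`: if every `x` with `Obl x` is good then `#Bad ≤ #Good`;
  `card_le_card_of_pairwise'`: the same with target `Good ∪ Good̄` (a point of the obligation set may
  instead have a good complement lying outside the obligation set).
* The corner `K t = supp t`, `ρ = id` is the Marica–Schönheim/"HL" count: if every point above some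
  `t₁ ∪ t₂ᶜ` (`t₁, t₂ ∈ Bad`) is good then `#Bad ≤ #Good` (`card_le_card_of_forall_sup_sdiff`) — the
  localized oriented antipodal Hall inequality for HL-closed type sets, here from Reimer's lemma
  instead of `Finset.card_le_card_diffs`.

Computationally (memo §2) certificates with `ρ t ∈ {t, t̄}` exist for every OTA instance on `B_m`,
`m ≤ 3` (24,050,704 instances, including the 15,504 where the signed Marica–Schönheim count fails) and
for every antipodal graph fibre with `≤ 6` edges on `≤ 6` vertices; a uniform certificate would close
`Q44b ∀n` through `card_le_card_of_pairwise`.  (prim-l12-p1 gen 7, 2026-08-21.)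
-/

namespace Summit.CriticalPhenomena.PercolationContinuityZ3.Theorems

namespace Q44bReimer

open Finset

variable {α : Type*} [Fintype α] [DecidableEq α]

/-- **The obligation set of a certificate, pointwise.**  For the events
`A = ⋃_{t∈Bad} {x | x = ρ t on K t}` and `B = ⋃_{t∈Bad} {x | x = ρ t off K t}`, a point `x` lies in
`A ∩ B̄` iff it agrees with some `ρ t₁` on `K t₁` and satisfies `x i = !ρ t₂ i` off `K t₂` for some
bad `t₂`. [this work] -/
theorem mem_obligation_iff (Bad : Finset (α → Bool)) (ρ : (α → Bool) → (α → Bool))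
    (K : (α → Bool) → Finset α) (x : α → Bool) :
    x ∈ (Bad.biUnion fun t => univ.filter fun x : α → Bool => ∀ i ∈ K t, x i = ρ t i) ∩
        (Bad.biUnion fun t => univ.filter fun x : α → Bool => ∀ i, i ∉ K t → x i = ρ t i).image
          (fun x i => !x i) ↔
      (∃ t₁ ∈ Bad, ∀ i ∈ K t₁, x i = ρ t₁ i) ∧
        (∃ t₂ ∈ Bad, ∀ i, i ∉ K t₂ → x i = !ρ t₂ i) := by
  simp only [mem_inter, mem_biUnion, mem_filter, mem_univ, true_and, mem_image]
  constructor
  · rintro ⟨h1, ⟨y, ⟨t₂, ht₂, hy⟩, hyx⟩⟩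
    refine ⟨h1, t₂, ht₂, fun i hi => ?_⟩
    rw [← hyx]
    simp [hy i hi]
  · rintro ⟨h1, t₂, ht₂, h2⟩
    refine ⟨h1, fun i => !x i, ⟨t₂, ht₂, fun i hi => ?_⟩, ?_⟩
    · simp [h2 i hi]
    · funext i; simp

/-- **Reimer step.**  For a representative map `ρ` injective on `Bad` and arbitrary witnesses `K`,
`#Bad ≤ #(A ∩ B̄)` with `A, B` as in `mem_obligation_iff`: every `ρ t` lies in `A □ B` with witness
`K t`, and Reimer's flip lemma bounds `|A □ B|`. [cite: ReimerCPC2000, Thm. 1.2] (through the tree's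
`Literature.Probability.Percolation.reimer_flip_card_le`) [this work] -/
theorem card_le_card_obligation {Bad : Finset (α → Bool)} {ρ : (α → Bool) → (α → Bool)}
    (K : (α → Bool) → Finset α) (hinj : Set.InjOn ρ Bad) :
    Bad.card ≤
      ((Bad.biUnion fun t => univ.filter fun x : α → Bool => ∀ i ∈ K t, x i = ρ t i) ∩
        (Bad.biUnion fun t => univ.filter fun x : α → Bool => ∀ i, i ∉ K t → x i = ρ t i).image
          (fun x i => !x i)).card := by
  classical
  set A := Bad.biUnion fun t => univ.filter fun x : α → Bool => ∀ i ∈ K t, x i = ρ t i with hA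
  set B := Bad.biUnion fun t => univ.filter fun x : α → Bool => ∀ i, i ∉ K t → x i = ρ t i with hB
  have hR := Literature.Probability.Percolation.reimer_flip_card_le A B
  rw [← card_image_of_injOn hinj]
  refine le_trans (card_le_card ?_) hR
  intro r hr
  obtain ⟨t, ht, rfl⟩ := mem_image.1 hr
  refine mem_filter.2 ⟨mem_univ _, K t, ?_, ?_⟩
  · intro z hz
    exact mem_biUnion.2 ⟨t, ht, mem_filter.2 ⟨mem_univ _, hz⟩⟩
  · intro z hz
    exact mem_biUnion.2 ⟨t, ht, mem_filter.2 ⟨mem_univ _, hz⟩⟩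

/-- **Certificate theorem, plain target.**  If for all bad `t₁, t₂` every point agreeing with `ρ t₁`
on `K t₁` and with the complement of `ρ t₂` off `K t₂` is good, then `#Bad ≤ #Good`. [this work] -/
theorem card_le_card_of_pairwise {Bad Good : Finset (α → Bool)} {ρ : (α → Bool) → (α → Bool)}
    (K : (α → Bool) → Finset α) (hinj : Set.InjOn ρ Bad)
    (hpair : ∀ t₁ ∈ Bad, ∀ t₂ ∈ Bad, ∀ x : α → Bool,
      (∀ i ∈ K t₁, x i = ρ t₁ i) → (∀ i, i ∉ K t₂ → x i = !ρ t₂ i) → x ∈ Good) :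
    Bad.card ≤ Good.card := by
  refine (card_le_card_obligation K hinj).trans (card_le_card fun x hx => ?_)
  obtain ⟨⟨t₁, ht₁, h₁⟩, ⟨t₂, ht₂, h₂⟩⟩ := (mem_obligation_iff Bad ρ K x).1 hx
  exact hpair t₁ ht₁ t₂ ht₂ x h₁ h₂

/-- **Certificate theorem, target `Good ∪ Good̄`.**  Write `Obl x` for the pairwise obligation
predicate of `mem_obligation_iff`.  If every `x` with `Obl x` is good, or has a good complement `x̄`
with `¬ Obl x̄`, then `#Bad ≤ #Good` (the map `x ↦ x` resp. `x ↦ x̄` is injective on the obligation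
set, good points and complements of good points being handled separately). [this work] -/
theorem card_le_card_of_pairwise' {Bad Good : Finset (α → Bool)} {ρ : (α → Bool) → (α → Bool)}
    (K : (α → Bool) → Finset α) (hinj : Set.InjOn ρ Bad)
    (hpair : ∀ x : α → Bool,
      ((∃ t₁ ∈ Bad, ∀ i ∈ K t₁, x i = ρ t₁ i) ∧ (∃ t₂ ∈ Bad, ∀ i, i ∉ K t₂ → x i = !ρ t₂ i)) →
        x ∈ Good ∨
          ((fun i => !x i) ∈ Good ∧
            ¬ ((∃ t₁ ∈ Bad, ∀ i ∈ K t₁, (!x i) = ρ t₁ i) ∧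
                (∃ t₂ ∈ Bad, ∀ i, i ∉ K t₂ → (!x i) = !ρ t₂ i)))) :
    Bad.card ≤ Good.card := by
  classical
  set S := (Bad.biUnion fun t => univ.filter fun x : α → Bool => ∀ i ∈ K t, x i = ρ t i) ∩
        (Bad.biUnion fun t => univ.filter fun x : α → Bool => ∀ i, i ∉ K t → x i = ρ t i).image
          (fun x i => !x i) with hSdef
  have hmemS : ∀ x, x ∈ S ↔ (∃ t₁ ∈ Bad, ∀ i ∈ K t₁, x i = ρ t₁ i) ∧
      (∃ t₂ ∈ Bad, ∀ i, i ∉ K t₂ → x i = !ρ t₂ i) := fun x => mem_obligation_iff Bad ρ K x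
  have hS : ∀ x ∈ S, x ∈ Good ∨ ((fun i => !x i) ∈ Good ∧ (fun i => !x i) ∉ S) := by
    intro x hx
    rcases hpair x ((hmemS x).1 hx) with h | ⟨h1, h2⟩
    · exact Or.inl h
    · refine Or.inr ⟨h1, fun h => h2 ?_⟩
      exact (hmemS _).1 h
  let f : (α → Bool) → (α → Bool) := fun x => if x ∈ Good then x else fun i => !x i
  have hflip : ∀ x y : α → Bool, (fun i => !x i) = (fun i => !y i) → x = y := by
    intro x y h
    funext i
    have := congrFun h i
    simpa using this
  have hmaps : Set.MapsTo f S Good := by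
    intro x hx
    by_cases hg : x ∈ Good
    · simp [f, hg]
    · rcases hS x hx with h | ⟨h, -⟩
      · exact absurd h hg
      · simpa [f, hg] using h
  have hinjf : Set.InjOn f S := by
    intro x hx y hy hxy
    by_cases hgx : x ∈ Good <;> by_cases hgy : y ∈ Good
    · simpa [f, hgx, hgy] using hxy
    · simp only [f, hgx, hgy, if_true, if_false] at hxy
      rcases hS y hy with h | ⟨-, h⟩
      · exact absurd h hgy
      · exact absurd (hxy ▸ hx) h
    · simp only [f, hgx, hgy, if_true, if_false] at hxy
      rcases hS x hx with h | ⟨-, h⟩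
      · exact absurd h hgx
      · exact absurd (hxy ▸ hy) h
    · simp only [f, hgx, hgy, if_false] at hxy
      exact hflip x y hxy
  exact (card_le_card_obligation K hinj).trans (card_le_card_of_injOn f hmaps hinjf)

/-- **The Marica–Schönheim corner** (`ρ = id`, `K t = supp t`): if every point lying above some
`t₁ ∪ t₂ᶜ` (`t₁, t₂ ∈ Bad`; in Boolean terms `x i = true` whenever `t₁ i = true` or `t₂ i = false`) is
good, then `#Bad ≤ #Good`.  This is the HL-closed case of the oriented antipodal Hall count, obtained
here from Reimer's lemma rather than from `|𝒜 \\ 𝒜| ≥ |𝒜|`. [this work] -/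
theorem card_le_card_of_forall_sup_sdiff {Bad Good : Finset (α → Bool)}
    (hHL : ∀ t₁ ∈ Bad, ∀ t₂ ∈ Bad, ∀ x : α → Bool,
      (∀ i, t₁ i = true ∨ t₂ i = false → x i = true) → x ∈ Good) :
    Bad.card ≤ Good.card := by
  refine card_le_card_of_pairwise (ρ := id) (fun t => univ.filter fun i => t i = true)
    (Set.injOn_id _) ?_
  intro t₁ ht₁ t₂ ht₂ x h₁ h₂
  refine hHL t₁ ht₁ t₂ ht₂ x fun i hi => ?_
  rcases hi with hi | hi
  · have := h₁ i (mem_filter.2 ⟨mem_univ _, hi⟩)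
    simpa [hi] using this
  · have hi' : i ∉ univ.filter fun j => t₂ j = true := by simp [hi]
    have := h₂ i hi'
    simpa [hi] using this

end Q44bReimer

end Summit.CriticalPhenomena.PercolationContinuityZ3.Theorems
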